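/-
Copyright (c) 2026 the pub-hodgecm-mathlib formalisation cell (harness21).  Prover seat hodgecm-mathlib-K2E4-p14 (g7), Track B ∕ K2-LIT, h413 =
`stmt-HodgeConjecture-24833`, line `K2_E1_TraceFormulaBeta`, campaign «EIS-R7-BL-SPH-3» (dealer K2E1-plan (g6) WAVE 1 2026-09-04T09:52:04Z (5) «ℓ7₃ AUDIT-AND-TWIN»):
Bernstein–Lapid's constant-term vectors at the `U(2,1)` pole parameter `ρ₀ = 2` — `α₂(z) = [H^{2−z}]`.
-/
import Summits.HodgeConjecture.HodgeConjecture.Theorems.K2E1BLConstantTermVectorsU2     -- ★ p859032 (K2E3-p12 g7): `exists_HN_ae_eq_cpow`, `ne_zero_of_ae_eq_cpow` (RANK-GENERIC); brings ★ ℓ7 p858977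
import HarnessLib

/-!
# K2·E1 — `K2E1BLConstantTermVectorsU3`: THE CONSTANT-TERM VECTORS AT `ρ₀ = 2` — `α₁(z) = [H^z]`, `α₂(z) = [H^{2−z}]` IN `𝓗_k(Z_c)` ON `ball 0 (n + 2)` WITH `n + 4 ≤ k`,
# HOLOMORPHIC AND NON-ZERO (the `U(2,1)` twin of ★ `K2E1BLConstantTermVectorsU2` §4 and of ★ ℓ7 `differentiableOn_HN_of_ae_eq_cpow_one_sub`)

Track B ∕ K2-LIT, crux h413 = `stmt-HodgeConjecture-24833`, route of record `HCCMUnconditional`; cell `hodgecm-mathlib`, squad K2, ENGINE E1.  Prover seat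
`hodgecm-mathlib-K2E4-p14` (g7).  THEOREMS ONLY (no `def`, no `instance`, no notation, no named-fact hypothesis, no `sorry`); lane `--supports stmt-HodgeConjecture-24833
--as helper` (count-neutral).  Closes no socket.  RANK-GENERIC in `N` (stated on `borelQuotient F E c N`); what is `U(2,1)`-specific is only the EXPONENT `2 − z` (pole
parameter `ρ₀ = 2ρ_H = 2` at `N = 3`, INFO #22).

AUDIT (dealer (5)): ★ `K2E1BLHeightPowerHolomorphicU2` (ℓ7: `differentiableOn_of_weighted_bound`, `differentiableOn_Lp_cpow`, `differentiableOn_HN_of_ae_eq_cpow`) and ★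
`K2E1BLConstantTermVectorsU2` §1–§3 (`memLp_borelQuotHeight_cpow`, `exists_HN_ae_eq_cpow (φ)`, `ne_zero_of_ae_eq_cpow`) are GENERIC (any `N`, any exponent map `φ`) — CITE BY NAME.
Rank-shaped are exactly two corollaries with the exponent `1 − z` (`ρ₀ = 1`): `differentiableOn_HN_of_ae_eq_cpow_one_sub` and the package `exists_constantTermVectors` (`n + 3 ≤ k`).
This file supplies their `ρ₀ = 2` twins:
* §1 **`differentiableOn_HN_of_ae_eq_cpow_two_sub`** — `α z =ᵐ H^{2−z}` on an open `U ⊆ {σ₀ ≤ 2 − Re z ≤ σ₁}` (`σ₀, σ₁ ≤ k`) ⟹ `α` holomorphic on `U` (★ ℓ7 at `φ = 2 − z`).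
* §2 **`exists_constantTermVectors_two_sub (n) (hk : n + 4 ≤ k)`** — on `ball 0 (n + 2)` (where `Re z ∈ (−n−2, n+2)`, so `Re(2−z) ∈ (−n, n+4)`): `∃ α₁ α₂ : ℂ → 𝓗_k(Z_c)` with
  `α₁ z =ᵐ H^z`, `α₂ z =ᵐ H^{2−z}`, `α₁ z ≠ 0`, `α₂ z ≠ 0` — the letters `hα₁ hα₂ hα₂ne` of the `N = 3` closer (K2E3-p12's `…_ball_of_letters` at `(σ₀, ρ₀) = (2, 2)`); and
  **`differentiableOn_constantTermVectors_two_sub`**: both are holomorphic on the ball (§1 + ★ `…_cpow_self`).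
HONEST LABEL: HC_CM is proved only modulo the 7 printed citations (2 remaining named inputs: hLiu418 = `stmt-HodgeConjecture-24832`, h413 = `stmt-HodgeConjecture-24833`) until rung 0
closes; this file asserts no named fact and closes no socket; hypotheses `hfin`∕`hne` (`0 < μZ(Z_c) < ∞`) are the same data clauses as ★ p859032's.
References: [BernsteinLapid2019] J. Bernstein, E. Lapid, *On the meromorphic continuation of Eisenstein series*, arXiv:1911.02342, §4 p. 10 · [Rogawski1990] §2.2 (`2ρ` for `U(2,1)`).
-/

set_option autoImplicit false
-- the mandated namespace repeats the single-problem summit's segment (`HodgeConjecture.HodgeConjecture`)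
set_option linter.dupNamespace false

noncomputable section

open MeasureTheory Filter Topology Set NumberField
open scoped NNReal ENNReal Classical
open Literature.NumberTheory.Automorphic Literature.NumberTheory.Automorphic.UnitaryGroup
open Summit.HodgeConjecture.HodgeConjecture.Cruxes.H413.K2E1BLBorelSpacesU2Defs
open Summit.HodgeConjecture.HodgeConjecture.Cruxes.H413.K2E1BLHeightPowerHolomorphicU2 (differentiableOn_HN_of_ae_eq_cpow differentiableOn_HN_of_ae_eq_cpow_self)
open Summit.HodgeConjecture.HodgeConjecture.Cruxes.H413.K2E1BLConstantTermVectorsU2 (exists_HN_ae_eq_cpow ne_zero_of_ae_eq_cpow)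

namespace Summit.HodgeConjecture.HodgeConjecture.Cruxes.H413.K2E1BLConstantTermVectorsU3

variable {F E : Type} [Field F] [NumberField F] [Field E] [NumberField E] [Algebra F E] {c : E ≃ₐ[F] E} {N : ℕ} [NeZero N]
variable {k : ℕ} {c₁ : ℝ≥0} {μZ : Measure (borelQuotient F E c N)}

/-! ## §1 `α₂(z) = [H^{2−z}]` is holomorphic -/

/-- **`α₂(z) = H^{2−z}|_{Z_c}` IS HOLOMORPHIC** on any open `U ⊆ {σ₀ ≤ 2 − Re z ≤ σ₁}` with `σ₀, σ₁ ≤ k`, `μZ(Z_c) < ∞` (in `=ᵐ` currency) — ★ ℓ7 `differentiableOn_HN_of_ae_eq_cpow` at the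
affine exponent `φ(z) = 2 − z` (`ρ₀ = 2`, `U(2,1)`). [cite: BernsteinLapid2019, §4 p. 10] [cite: Rogawski1990, §2.2] -/
theorem differentiableOn_HN_of_ae_eq_cpow_two_sub (hc₁ : 0 < c₁) (hfin : μZ {z | c₁ < borelQuotHeight F E c N z} ≠ ∞)
    {σ₀ σ₁ : ℝ} (hσ₀ : σ₀ ≤ k) (hσ₁ : σ₁ ≤ k) {U : Set ℂ} (hU : IsOpen U) (hUre : ∀ z ∈ U, σ₀ ≤ 2 - z.re ∧ 2 - z.re ≤ σ₁)
    {α : ℂ → HN F E c N k c₁ μZ} (hα : ∀ z ∈ U, (α z : borelQuotient F E c N → ℂ) =ᵐ[weightedTruncMeasure F E c N k c₁ μZ] fun x => (((borelQuotHeight F E c N x : ℝ≥0) : ℝ) : ℂ) ^ (2 - z)) :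
    DifferentiableOn ℂ α U :=
  differentiableOn_HN_of_ae_eq_cpow (φ := fun z : ℂ => 2 - z) hc₁ hfin hσ₀ hσ₁ hU (differentiableOn_id.const_sub (2 : ℂ))
    (fun z hz => by simpa only [Complex.sub_re, Complex.re_ofNat] using hUre z hz) hα

/-! ## §2 The package at `ρ₀ = 2` on `ball 0 (n + 2)` -/

/-- **THE CONSTANT-TERM VECTORS AT `ρ₀ = 2` ON `ball 0 (n + 2)`** (`n + 4 ≤ k`, `μZ(Z_c)` finite and non-zero): `∃ α₁ α₂ : ℂ → 𝓗_k(Z_c)` with `α₁ z =ᵐ H^z`, `α₂ z =ᵐ H^{2−z}`,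
both non-zero, for every `z` in the ball (`|Re z| < n + 2`, so `Re(2 − z) ∈ (−n, n + 4) ⊆ [−k, k]`) — the letters `hα₁ hα₂ hα₂ne` of the `N = 3` closer at `(σ₀, ρ₀) = (2, 2)`.
[cite: BernsteinLapid2019, §4 p. 10] [cite: Rogawski1990, §2.2] -/
theorem exists_constantTermVectors_two_sub (n : ℕ) (hk : (n : ℝ) + 4 ≤ k) (hc₁ : 0 < c₁) (hfin : μZ {z | c₁ < borelQuotHeight F E c N z} ≠ ∞)
    (hne : μZ {z | c₁ < borelQuotHeight F E c N z} ≠ 0) :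
    ∃ α₁ α₂ : ℂ → HN F E c N k c₁ μZ,
      (∀ z ∈ Metric.ball (0 : ℂ) (n + 2), (α₁ z : borelQuotient F E c N → ℂ) =ᵐ[weightedTruncMeasure F E c N k c₁ μZ] fun x => (((borelQuotHeight F E c N x : ℝ≥0) : ℝ) : ℂ) ^ z) ∧
      (∀ z ∈ Metric.ball (0 : ℂ) (n + 2), (α₂ z : borelQuotient F E c N → ℂ) =ᵐ[weightedTruncMeasure F E c N k c₁ μZ] fun x => (((borelQuotHeight F E c N x : ℝ≥0) : ℝ) : ℂ) ^ (2 - z)) ∧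
      (∀ z ∈ Metric.ball (0 : ℂ) (n + 2), α₁ z ≠ 0) ∧ (∀ z ∈ Metric.ball (0 : ℂ) (n + 2), α₂ z ≠ 0) := by
  have hre : ∀ z ∈ Metric.ball (0 : ℂ) (n + 2), |z.re| < n + 2 := fun z hz =>
    lt_of_le_of_lt (Complex.abs_re_le_norm z) (by rwa [Metric.mem_ball, dist_zero_right] at hz)
  obtain ⟨α₁, hα₁⟩ := exists_HN_ae_eq_cpow (k := k) hc₁ hfin (σ₀ := -((n : ℝ) + 2)) (σ₁ := (n : ℝ) + 2) (by linarith) (by linarith) (fun z : ℂ => z)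
    (U := Metric.ball (0 : ℂ) (n + 2)) fun z hz => ⟨by linarith [(abs_lt.1 (hre z hz)).1], by linarith [(abs_lt.1 (hre z hz)).2]⟩
  obtain ⟨α₂, hα₂⟩ := exists_HN_ae_eq_cpow (k := k) hc₁ hfin (σ₀ := -(n : ℝ)) (σ₁ := (n : ℝ) + 4) (by linarith) (by linarith) (fun z : ℂ => 2 - z)
    (U := Metric.ball (0 : ℂ) (n + 2)) fun z hz => by
      simp only [Complex.sub_re, Complex.re_ofNat]
      exact ⟨by linarith [(abs_lt.1 (hre z hz)).2], by linarith [(abs_lt.1 (hre z hz)).1]⟩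
  exact ⟨α₁, α₂, hα₁, hα₂, fun z hz => ne_zero_of_ae_eq_cpow hne (hα₁ z hz), fun z hz => ne_zero_of_ae_eq_cpow hne (hα₂ z hz)⟩

/-- **BOTH VECTORS ARE HOLOMORPHIC ON THE BALL** (`n + 4 ≤ k`): any `α₁, α₂` with `α₁ z =ᵐ H^z`, `α₂ z =ᵐ H^{2−z}` on `ball 0 (n + 2)` are `DifferentiableOn ℂ` there (★ ℓ7 `…_cpow_self` on the
window `[−(n+2), n+2]`, §1 on the window `[−n, n+4]`). [cite: BernsteinLapid2019, §4 p. 10] -/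
theorem differentiableOn_constantTermVectors_two_sub (n : ℕ) (hk : (n : ℝ) + 4 ≤ k) (hc₁ : 0 < c₁) (hfin : μZ {z | c₁ < borelQuotHeight F E c N z} ≠ ∞)
    {α₁ α₂ : ℂ → HN F E c N k c₁ μZ}
    (hα₁ : ∀ z ∈ Metric.ball (0 : ℂ) (n + 2), (α₁ z : borelQuotient F E c N → ℂ) =ᵐ[weightedTruncMeasure F E c N k c₁ μZ] fun x => (((borelQuotHeight F E c N x : ℝ≥0) : ℝ) : ℂ) ^ z)
    (hα₂ : ∀ z ∈ Metric.ball (0 : ℂ) (n + 2), (α₂ z : borelQuotient F E c N → ℂ) =ᵐ[weightedTruncMeasure F E c N k c₁ μZ] fun x => (((borelQuotHeight F E c N x : ℝ≥0) : ℝ) : ℂ) ^ (2 - z)) :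
    DifferentiableOn ℂ α₁ (Metric.ball (0 : ℂ) (n + 2)) ∧ DifferentiableOn ℂ α₂ (Metric.ball (0 : ℂ) (n + 2)) := by
  have hre : ∀ z ∈ Metric.ball (0 : ℂ) (n + 2), |z.re| < n + 2 := fun z hz =>
    lt_of_le_of_lt (Complex.abs_re_le_norm z) (by rwa [Metric.mem_ball, dist_zero_right] at hz)
  refine ⟨differentiableOn_HN_of_ae_eq_cpow_self hc₁ hfin (σ₀ := -((n : ℝ) + 2)) (σ₁ := (n : ℝ) + 2) (by linarith) (by linarith) Metric.isOpen_ball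
      (fun z hz => ⟨by linarith [(abs_lt.1 (hre z hz)).1], by linarith [(abs_lt.1 (hre z hz)).2]⟩) hα₁,
    differentiableOn_HN_of_ae_eq_cpow_two_sub hc₁ hfin (σ₀ := -(n : ℝ)) (σ₁ := (n : ℝ) + 4) (by linarith) (by linarith) Metric.isOpen_ball
      (fun z hz => ⟨by linarith [(abs_lt.1 (hre z hz)).2], by linarith [(abs_lt.1 (hre z hz)).1]⟩) hα₂⟩

end Summit.HodgeConjecture.HodgeConjecture.Cruxes.H413.K2E1BLConstantTermVectorsU3

end
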